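import Literature.NumberTheory.EllipticCurves.Jetchev2008.CoreVertices
import Summits.BirchSwinnertonDyer.BirchSwinnertonDyer.Theorems.Rank1ResidualJetLocalRestriction
import HarnessLib

/-!
# Crux U1 `KolyvaginBoundedDefectAtTwo` (stmt-BirchSwinnertonDyer-28083), LINE 17 `regular_core_rigidity` —
# brick for the Selmer-rank walk in Jetchev's PARAMETER-FREE currency: a class locally trivial above `ℓ`
# lies in `H_{𝓕(cℓ)}` iff it lies in `H_{𝓕(c)}` (the common STRICT part of the lozenge)

Width seat `bsd-line-krr2-p2` g12 (`--supports stmt-BirchSwinnertonDyer-28083`, helper). LINE 17's stubs S1/S2 are typed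
on `Jetchev2008.modifiedSelmerGroup W K ι n c = H_{𝓕(c)}(K, E[n])` (Kummer condition at the places of `K` not above a
prime factor of `c`, the GLOBAL transverse condition `transverseKer` at the prime factors of `c`). Every step
`c ↦ cℓ` of a core-vertex walk (Jetchev 2008 Lemma 5.2 / Mazur–Rubin 2004 §4.1; the sign-free walk of LINE 17's S1b) uses
the strict module `H_{𝓕_λ(c)} = {x ∈ H_{𝓕(c)} : loc_λ x = 0}` and the fact that it sits inside BOTH `H_{𝓕(c)}` and
`H_{𝓕(cℓ)}`: a class that dies at the places above `ℓ` satisfies the Kummer condition there (it is `0`) AND the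
transverse condition there (its restriction to `K[ℓ]` dies at every place `w ∣ ℓ` of `K[ℓ]`, by the functoriality
`loc_w ∘ res_{K[ℓ]/K} = r ∘ loc_v` — the tree theorem `JET.exists_localRestriction_compat`, gap G2 of cell bsd-jet).
In the `SelmerStructure` currency of the bsd-jet kernel this is the pair `hYker`/`hTker` of
`JET.Section6.lozenge_negSide`; here it is proved for the parameter-free `modifiedSelmerGroup`, at ANY level `n : ℤ`
and any prime `ℓ` (no inertness, no Kolyvagin condition needed):
* `mem_transverseKer_of_localization_eq_zero` — `loc_v x = 0` at every place `v ∋ ℓ` of `K` ⇒ `x ∈ transverseKer W K ι n ℓ`;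
* `mem_modifiedSelmerGroup_mul_iff_of_localization_eq_zero` — for such `x`: `x ∈ H_{𝓕(cℓ)} ↔ x ∈ H_{𝓕(c)}`;
* `mem_modifiedSelmerGroup_mul_of_localization_eq_zero` — the survival direction used by the walk («a survivor
  prescribed to die at `λ` stays in the modified Selmer group»).
Nothing here proves S1, U1 or BSD. BSD is NOT proved.
References: [cite: Jetchev2008, §3.1.2 (p. 814), §3.4.1 (p. 816), Lemma 5.2 (p. 821)] [cite: MazurRubin2004, §4.1]
[cite: SerreLocalFields1979, VII.§5 Prop. 3]. Design: theorems only; `K : Type`; axioms `propext`, `Classical.choice`,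
`Quot.sound`.
-/

set_option autoImplicit false
-- the Theorems namespace of this sub repeats the summit name by design (D-0017 nested layout)
set_option linter.dupNamespace false

noncomputable section

open scoped Classical

open WeierstrassCurve NumberField IsDedekindDomain Field
open Literature.NumberTheory.GaloisRepresentations Literature.NumberTheory.EllipticCurves
open Literature.NumberTheory.EllipticCurves.Jetchev2008

namespace Summit.BirchSwinnertonDyer.BirchSwinnertonDyer.Theorems.KolyvaginAtTwo.ModifiedSelmer

variable (W : WeierstrassCurve ℚ) (K : Type) [Field K] [NumberField K] (ι : K →+* ℂ)

/-- **Locally trivial above `ℓ` ⇒ transverse at `ℓ`.** If `loc_v x = 0` at every finite place `v` of `K` containing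
`ℓ ≠ 0`, then `x ∈ transverseKer W K ι n ℓ`: for a place `w` of `K[ℓ]` containing `ℓ`, the place `v = w ∩ 𝓞_K` of `K`
contains `ℓ`, and `loc_w (res_{K[ℓ]/K} x) = r (loc_v x) = r 0 = 0` by the functoriality of restriction on local
cohomology (`JET.exists_localRestriction_compat`). [cite: Jetchev2008, §3.1.2 (p. 814)]
[cite: SerreLocalFields1979, VII.§5 Prop. 3] -/
theorem mem_transverseKer_of_localization_eq_zero (n : ℤ) {ℓ : ℕ} (hℓ : ℓ ≠ 0)
    [NumberField (ringClassField K ι ℓ)]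
    {x : galoisCohomology ((W.baseChange K).torsionGaloisModule n) 1}
    (hx : ∀ v : HeightOneSpectrum (𝓞 K), (ℓ : 𝓞 K) ∈ v.asIdeal →
      galoisCohomology.localization ((W.baseChange K).torsionGaloisModule n) (Sum.inr v) 1 x = 0) :
    x ∈ transverseKer W K ι n ℓ := by
  rw [mem_transverseKer_iff]
  intro w hw
  -- the place of `K` under `w`
  have hunder : (ℓ : 𝓞 K) ∈ w.asIdeal.under (𝓞 K) := by
    rw [Ideal.under, Ideal.mem_comap, map_natCast]
    exact hw
  have hne : w.asIdeal.under (𝓞 K) ≠ ⊥ := by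
    intro h
    rw [h, Ideal.mem_bot] at hunder
    exact hℓ (by exact_mod_cast hunder)
  let v : HeightOneSpectrum (𝓞 K) := ⟨w.asIdeal.under (𝓞 K), Ideal.IsPrime.under (𝓞 K) w.asIdeal, hne⟩
  haveI : w.asIdeal.LiesOver v.asIdeal := ⟨rfl⟩
  obtain ⟨r, hr⟩ := Summit.BirchSwinnertonDyer.Rank1Residual.JET.exists_localRestriction_compat
    ((W.baseChange K).torsionGaloisModule n) (ringClassField K ι ℓ) v w
  rw [← hr x, hx v hunder, map_zero]

/-- **The common strict part of the lozenge, parameter-free currency.** For a prime `ℓ` and a class `x` with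
`loc_v x = 0` at every place `v ∋ ℓ` of `K`: `x ∈ H_{𝓕(cℓ)}(K, E[n]) ↔ x ∈ H_{𝓕(c)}(K, E[n])` — at the places above `ℓ`
both the Kummer condition (`0 ∈` the local Kummer group) and the transverse condition
(`mem_transverseKer_of_localization_eq_zero`) hold for `x`, and the conditions at all other places agree.
(`c = 0` is harmless: both sides are then the Selmer group of the Kummer structure.)
[cite: Jetchev2008, §3.4.1 (p. 816), Lemma 5.2 (p. 821)] [cite: MazurRubin2004, §4.1] -/
theorem mem_modifiedSelmerGroup_mul_iff_of_localization_eq_zero [∀ k : ℕ, NumberField (ringClassField K ι k)]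
    (n : ℤ) (c : ℕ) {ℓ : ℕ} (hℓ : ℓ.Prime)
    {x : galoisCohomology ((W.baseChange K).torsionGaloisModule n) 1}
    (hx : ∀ v : HeightOneSpectrum (𝓞 K), (ℓ : 𝓞 K) ∈ v.asIdeal →
      galoisCohomology.localization ((W.baseChange K).torsionGaloisModule n) (Sum.inr v) 1 x = 0) :
    x ∈ modifiedSelmerGroup W K ι n (c * ℓ) ↔ x ∈ modifiedSelmerGroup W K ι n c := by
  rcases eq_or_ne c 0 with rfl | hc
  · rw [zero_mul]
  have hfac : (c * ℓ).primeFactors = c.primeFactors ∪ {ℓ} := by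
    rw [Nat.primeFactors_mul hc hℓ.ne_zero, hℓ.primeFactors]
  -- at a place over `ℓ` the class is `0` locally, hence Kummer there
  have hKum : ∀ v : Place K, PlaceOver K v ℓ →
      galoisCohomology.localization ((W.baseChange K).torsionGaloisModule n) v 1 x ∈
        (W.baseChange K).kummerSelmerStructure n v := by
    rintro v ⟨𝔳, rfl, h𝔳⟩
    rw [hx 𝔳 h𝔳]
    exact AddSubgroup.zero_mem _
  rw [mem_modifiedSelmerGroup_iff, mem_modifiedSelmerGroup_iff, hfac]
  constructor
  · rintro ⟨hK, hT⟩
    refine ⟨fun v hv ↦ ?_, fun q hq ↦ hT q (Finset.mem_union_left _ hq)⟩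
    by_cases hvl : PlaceOver K v ℓ
    · exact hKum v hvl
    · refine hK v fun q hq ↦ ?_
      rcases Finset.mem_union.mp hq with hq | hq
      · exact hv q hq
      · rw [Finset.mem_singleton] at hq
        exact hq ▸ hvl
  · rintro ⟨hK, hT⟩
    refine ⟨fun v hv ↦ hK v fun q hq ↦ hv q (Finset.mem_union_left _ hq), fun q hq ↦ ?_⟩
    rcases Finset.mem_union.mp hq with hq | hq
    · exact hT q hq
    · rw [Finset.mem_singleton] at hq
      subst hq
      exact mem_transverseKer_of_localization_eq_zero W K ι n hℓ.ne_zero hx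

/-- **Survival.** A class of `H_{𝓕(c)}(K, E[n])` that is locally trivial at the places above a prime `ℓ` lies in
`H_{𝓕(cℓ)}(K, E[n])` — the step «prescribe `loc_λ x = 0` for the designated survivor» of every Selmer-rank walk
(Jetchev's `H_{𝓕_λ(c)} ⊆ H_{𝓕(cℓ)}`). [cite: Jetchev2008, Lemma 5.2 (p. 821)] [cite: MazurRubin2004, §4.1] -/
theorem mem_modifiedSelmerGroup_mul_of_localization_eq_zero [∀ k : ℕ, NumberField (ringClassField K ι k)]
    (n : ℤ) {c ℓ : ℕ} (hℓ : ℓ.Prime)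
    {x : galoisCohomology ((W.baseChange K).torsionGaloisModule n) 1}
    (hxc : x ∈ modifiedSelmerGroup W K ι n c)
    (hx : ∀ v : HeightOneSpectrum (𝓞 K), (ℓ : 𝓞 K) ∈ v.asIdeal →
      galoisCohomology.localization ((W.baseChange K).torsionGaloisModule n) (Sum.inr v) 1 x = 0) :
    x ∈ modifiedSelmerGroup W K ι n (c * ℓ) :=
  (mem_modifiedSelmerGroup_mul_iff_of_localization_eq_zero W K ι n c hℓ hx).mpr hxc

end Summit.BirchSwinnertonDyer.BirchSwinnertonDyer.Theorems.KolyvaginAtTwo.ModifiedSelmer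

end
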